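import Summits.KontsevichZagierPeriods.KontsevichZagierPeriods.Theses.HurwitzMicroSectors
import Summits.KontsevichZagierPeriods.KontsevichZagierPeriods.Theorems.HurwitzMicroSectorsNormalFormPrinciplePiBoxTransfer
import Summits.KontsevichZagierPeriods.KontsevichZagierPeriods.Theorems.HurwitzMicroSectorsNormalFormPrincipleVariants2200

/-! TTRL-lite variant V2246 of stmt-KontsevichZagierPeriods-3869

Variant V2246 = `stub_boxRigidity` under the programmatic move `bound_nat:m'≤4` (the right dimension
bounded, the left dimension `m` free). Verdict of the attempt seat: **open, and provably as hard as
the parent** — this file is the certificate, not a proof of the variant. For EVERY bound `k` the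
statement "BoxRigidity for all `m` and all `m' ≤ k`" is equivalent to the whole leaf `BoxRigidity`
(general `k`: `boxRigidityRightLe_iff` of V2256's certificate; here `k = 4` directly): it contains the slice `m' = 0` (`BoxRigidityRight 0` of V2200's
certificate, `boxRigidityRight_iff`), whose second representation is a rational constant, and that
slice already forces BoxVanishing in every dimension, which is BoxRigidity
(`boxRigidity_of_boxVanishing`, tree). Hence `KontsevichZagierPeriods → V2246 → KZ.PiLocalKernel`
(`stub_boxRigidity_var2246_of_statement`, `piLocalKernel_of_stub_boxRigidity_var2246`): the variant
sits between the Summit and Ayoub's localised kernel conjecture (open), so it is neither provable nor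
refutable from the tree, and `Summit ⟺ V2246 ∧ PiCancellation`. The moves `bound_nat:m'≤k` /
`bound_nat:m≤k` of this stub never produce an easier statement; only TWO-sided bounds do (the
instance `m, m' ≤ 1` is the tree's `boxRigidity_of_le_one`).
Source: M. Kontsevich, D. Zagier, *Periods* (2001), §1.2 Conjecture 1; J. Ayoub, EMS Newsl. 91
(2014), Conj. 7. Pure proof file, no definitions. -/

-- `Summit.<Summit>.<Problem>` is the tree's mandated summit-side namespace (CONVENTIONS §2); for this
-- single-conjunct summit the two coincide, so the duplicate is deliberate.
set_option linter.dupNamespace false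

noncomputable section

namespace Summit.KontsevichZagierPeriods.KontsevichZagierPeriods.Theorems

open MeasureTheory Set
open Literature.NumberTheory.Transcendental Literature.NumberTheory.Transcendental.KZ
open Summit.KontsevichZagierPeriods.KontsevichZagierPeriods.Theses.HurwitzMicroSectors
open Summit.KontsevichZagierPeriods.HurwitzMicroSectors.NormalFormPrinciple.PiBox

/-! ## The variant V2246 itself: between the Summit and `KZ.PiLocalKernel` -/

/-- **V2246 ⟺ the parent leaf `BoxRigidity`** (the slice `m' = 0` is `BoxRigidityRight 0`, which is the whole leaf by V2200's `boxRigidityRight_iff 0`; equally the instance `k = 4` of V2256's `boxRigidityRightLe_iff`).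
[cite: KontsevichZagier2001, §1.2 Conjecture 1] -/
theorem stub_boxRigidity_var2246_iff_parent :
    (∀ (m m' : ℕ) (N : IntegralRep m) (N' : IntegralRep m'), m' ≤ 4 → N.domain = {x | ∀ i, x i ∈ Set.Ioo (0:ℝ) 1} → N.IsRational → N'.domain = {x | ∀ i, x i ∈ Set.Ioo (0:ℝ) 1} → N'.IsRational → N.value = N'.value → Equivalent N N') ↔
    (∀ (m m' : ℕ) (N : IntegralRep m) (N' : IntegralRep m'), N.domain = {x | ∀ i, x i ∈ Set.Ioo (0:ℝ) 1} → N.IsRational → N'.domain = {x | ∀ i, x i ∈ Set.Ioo (0:ℝ) 1} → N'.IsRational → N.value = N'.value → Equivalent N N') :=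
  ⟨fun h => (boxRigidityRight_iff 0).1 fun m N N' => h m 0 N N' (Nat.zero_le 4),
    fun h m m' N N' _ => h m m' N N'⟩

/-- **V2246 ⇒ `KZ.PiLocalKernel`** (Ayoub's localised kernel conjecture for this calculus — open): so a
proof of the variant would settle an open conjecture of the tree. [cite: Ayoub2014, Def. 6 and Conj. 7] -/
theorem piLocalKernel_of_stub_boxRigidity_var2246
    (h : ∀ (m m' : ℕ) (N : IntegralRep m) (N' : IntegralRep m'), m' ≤ 4 → N.domain = {x | ∀ i, x i ∈ Set.Ioo (0:ℝ) 1} → N.IsRational → N'.domain = {x | ∀ i, x i ∈ Set.Ioo (0:ℝ) 1} → N'.IsRational → N.value = N'.value → Equivalent N N') :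
    PiLocalKernel :=
  piLocalKernel_of_boxRigidity (stub_boxRigidity_var2246_iff_parent.1 h)

/-- **`KontsevichZagierPeriods ⇒ V2246`**: the variant is a special case of Conjecture 1 for the
tree's calculus — so a refutation of the variant would refute the Summit. [cite: KontsevichZagier2001, §1.2 Conjecture 1] -/
theorem stub_boxRigidity_var2246_of_statement (h : _root_.KontsevichZagierPeriods) :
    ∀ (m m' : ℕ) (N : IntegralRep m) (N' : IntegralRep m'), m' ≤ 4 → N.domain = {x | ∀ i, x i ∈ Set.Ioo (0:ℝ) 1} → N.IsRational → N'.domain = {x | ∀ i, x i ∈ Set.Ioo (0:ℝ) 1} → N'.IsRational → N.value = N'.value → Equivalent N N' :=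
  fun m m' N N' _ => (leaves_of_statement h).1 m m' N N'

/-- **Summit ⟺ V2246 ∧ PiCancellation** (from `statement_iff_leaves`): with `π`-cancellation the variant
is exactly what the Summit needs, no more and no less. [cite: KontsevichZagier2001, §1.2 Conjecture 1] -/
theorem statement_iff_stub_boxRigidity_var2246_and_piCancellation :
    _root_.KontsevichZagierPeriods ↔
    ((∀ (m m' : ℕ) (N : IntegralRep m) (N' : IntegralRep m'), m' ≤ 4 → N.domain = {x | ∀ i, x i ∈ Set.Ioo (0:ℝ) 1} → N.IsRational → N'.domain = {x | ∀ i, x i ∈ Set.Ioo (0:ℝ) 1} → N'.IsRational → N.value = N'.value → Equivalent N N') ∧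
      PiCancellation) := by
  rw [statement_iff_leaves, stub_boxRigidity_var2246_iff_parent]

end Summit.KontsevichZagierPeriods.KontsevichZagierPeriods.Theorems

end
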